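/-
Copyright (c) 2026 the pub-hodgecm-mathlib formalisation cell (harness21).  Prover seat hodgecm-mathlib-K2E4-p11 (g9): Track B «K2-LIT»,
#184♮ = hLiu418 = stmt-HodgeConjecture-24832; socket #41 KIND W — (ii)′ THE ∃-CARRIER CM ASSEMBLER OF ★ `kindW_block_of_record_local` WITH THE LETTERS
`hJ`, `hfsupp`, `hfsize`, `harch` DISCHARGED BY NAME INSIDE (LEAD F0P6-plan (g14) BATCH #160 (1), desk F0P2-p08 (g3)); ★ p863055 `kindW_block_cm` (g8) re-issued.
THEOREMS ONLY (no `def`, no `instance`, no `notation`, no named-fact hypothesis, no `sorry`).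
-/
import Summits.HodgeConjecture.HodgeConjecture.Theorems.K2LiuSiegelEisensteinKindWOfRecordLocal   -- ★ p863069∕p863093 (K2E4-p10) `kindW_block_of_record_local` (⊇ ★ p862959, ★ p862988 carriers)
import Summits.HodgeConjecture.HodgeConjecture.Theorems.K2LiuSiegelEisensteinKindWArchAdapter    -- ★ p863137 (K2E4-p10) `harch_of_blockLetters` (∘ ★ p863039 `archGrowth_le_heightDecay_of_entryLetters`, LH4-p08)
import Summits.HodgeConjecture.HodgeConjecture.Theorems.K2LiuKindWFinitePartLettersOfRecord      -- ★ p863047 (K2E3-p29) `hfsupp_of_levelLetters`, `hfsize_of_placeLetters`, `hdelta_eq_zero_off`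
import Summits.HodgeConjecture.HodgeConjecture.Theorems.K2LiuKindWGoodPlaceFactorCofinite        -- ★ p863201 (F0P2-p08) `exists_finset_hJ_toHeckeCharacter` (∘ ★ p863148 `hJ_of_isGoodPlace`)
import HarnessLib

/-!
# Crux `HLiu418`, socket #41, KIND W — `K2LiuKindWBlockOfRecordCMOfLetters`: THE KIND-W PAYER HEAD, CARRIERS BUILT INSIDE, LETTERS `hJ hfsupp hfsize harch` DISCHARGED BY NAME

Cell `hodgecm-mathlib`, crux item hLiu418 = `stmt-HodgeConjecture-24832` (helper lane `--supports … --as helper`, count-neutral), route of record `HCCMUnconditional`;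
squad K2 ∕ K2Liu (L1, LEAD F0P6-plan (g14)), road `K2_Liu`, socket #41 `sig_K2LiuSiegelEisensteinContinuation`, KIND W block (13 slots at ★ TOP ED. 17–20;
consumer = K2E3-typ2 (g2)'s tie, KW desk of record F0P2-p08 (g3)).  Frame = ★ p862959's (`e : Fin 2 × Fin 1 ≃ Fin n`, `χ := μ̃ := toHeckeCharacter L lam⁻¹`, the TOP's `νN`),
plus the socket's own `hlam : IsConjugateSymplectic L lam`.

THE POINT.  ★ p863055 `K2LiuKindWBlockOfRecordCM.kindW_block_cm` (this seat, g8) and its local-exponent twin ★ p863093 `kindW_block_cm_local` (K2E4-p10) build the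
seven carrier ∕ character letters INSIDE (★ p862988) and leave twenty letters BY VALUE.  Four of those twenty now have ★ payers in the tree, each speaking its own
INPUT currency; THIS FILE plugs them in BY NAME, so that the tie's KIND-W residue is exactly the payers' input letters:
* `hJ` (the rank-two per-place letter off `U(S,h)`) ← ★ p863201 `K2LiuKindWGoodPlaceFactorCofinite.exists_finset_hJ_toHeckeCharacter` (∘ ★ p863148 `hJ_of_isGoodPlace`;
  `n := 2` by `subst` from the frame `e`): NO by-value letter — it needs only the socket's `lam hlam` and the carriers' own `hχ`, and returns a finite `U₁ ⊇ T₀ᶜᵃʳʳ`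
  (`T₀ᶜᵃʳʳ` = ★ p862988's bad set) off which `hJ` holds verbatim; the head's `T₀` IS this `U₁` (`νv hνK` are `T₀`-free, `hmap` is `∀ T`, `hχ` weakens along `T₀ᶜᵃʳʳ ⊆ U₁`).
* `hfsupp` (STAGE-2 per-place support, defect datum `(T_δ, δ, k)`) ← ★ p863047 `hfsupp_of_levelLetters` at the data of record (`mat := (↑)`, `ht := (↑)`, `N := n + n`,
  `κT := Fin m`, `Tfin S h := kindWFinset T₀ ↑S h`, `Ffin v j S s h := Ffin j S h v s`): INPUT = a level function `lev` with its height letter `hlev` (defect `δ₀` off `T_{δ₀}`,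
  exponent `k`), a conductor defect `c` off `T_c`, and the per-place support letter `hsuppLoc` in LEVEL currency; `T_δ := T_{δ₀} ∪ T_c`, `δ := δ₀ + c` (★ `hdelta_eq_zero_off`).
* `hfsize` (STAGE-2 finite size, every admissible `D`) ← ★ p863047 `hfsize_of_placeLetters` (`τ S := ‖(ι_∞ S_{ij})‖`, `hτ := le_rfl`): INPUT = uniform exponents `k₂ k₃`, a fixed
  defect set `T_β`, and the per-place size letter `hsizeLoc` in DENOMINATOR-EXPONENT currency; its global `N₂ N₃` are a fortiori local.
* `harch` (ARCH size, exponents `N₁ N′` local in `s`) ← ★ p863137 `K2LiuSiegelEisensteinKindWArchAdapter.harch_of_blockLetters` (∘ ★ p863039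
  `archGrowth_le_heightDecay_of_entryLetters`): INPUT = the index frames `φ A B Ainv Binv M_f hcover` (★ FILE 2d), the archimedean frames `w hw er T Tinv M` (★ G7-C), the
  convention `hFinf0` (`Finf j S s h = 0` at `det S = 0`) and the pointwise BLOCK LETTER `hBL` («Φ6b-ind» currency); `hc : c ≠ 1` is Mathlib `IsCMField.complexConj_ne_one`.
Then ★ p863069 `kindW_block_of_record_local` (exponents local in `s`, the TOP's `N_W := 0`).
**HEAD `kindW_block_cm_of_letters`**: `∃ T₀ νv (Haar) (σ-finite) νinf (σ-finite), hνK ∧ hmap ∧ hχ ∧ ∀ {fT} hfac {m} Finf Ffin hFinf hFfin hFinf0 hPart ‹(iii-fin) level∕size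
letters› ‹(iii-arch) frames + hBL›, ‹★ p862959's 13-slot KIND-W conclusion, verbatim›`.  RESIDUE BY VALUE for the tie (payers of record, LEAD BATCH #157∕#160): `fT hfac`
(KW-fac) K2E3-p26 · `Finf Ffin hFinf hFfin hFinf0 hPart` + the level∕size letters (iii-fin) K2E3-p29 (★ p863154 `K2LiuKindWFiniteLetterDefs`; `hPart` composes with ★
`hPart_of_letters` ∕ 📤 `kindW_block_cm_localLetters` in one line) · the frames + `hBL` (iii-arch) LH4-p08 (📤 p863152 `K2LiuKindWArchLetterDefs`) ∕ (iii-arch-hol) LH4-p10.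
GONE: `hJ`, `Tδ δ hδ hfsupp`, `N₁ N′ harch`, `N₂ N₃ hfsize` (and no `hε`∕parity letter: `hlam` is the socket's).
[CasselsFrohlichANT1967, Ch. XV (Tate) §3.3], [KudlaRallis1994, §1–§2], [Tan1999, §2–§4], [Shimura1982, §3], [Shimura1997, §18.1 (18.4), §18.4 Prop. 18.14, §19],
[GelbartRogawski1991, §3.1 (3.1.3)], [Liu2021, Def. 4.1, Rem. 4.4], [MoeglinWaldspurger1995, II.1.7, IV.1.9].
HONEST LABEL.  Count-neutral helper; it retires nothing by itself: `HC_CM` is proved only modulo the 7 printed citations (2 remaining named inputs: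
hLiu418 = `stmt-HodgeConjecture-24832`, h413 = `stmt-HodgeConjecture-24833`) until rung 0 closes.

## References
* [CasselsFrohlichANT1967] J. W. S. Cassels, A. Fröhlich (eds.), *Algebraic Number Theory* (1967), Ch. II §14, Ch. XV (Tate) §3.3.
* [KudlaRallis1994] S. Kudla, S. Rallis, *A regularized Siegel–Weil formula: the first term identity*, Ann. of Math. 140 (1994), §1–§2.
* [Tan1999] V. Tan, *Poles of Siegel Eisenstein series on U(n,n)*, Canad. J. Math. 51 (1999), §2–§4.
* [Shimura1982] G. Shimura, *Confluent hypergeometric functions on tube domains*, Math. Ann. 260 (1982), §3.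
* [Shimura1997] G. Shimura, *Euler products and Eisenstein series*, CBMS 93 (1997), §18.1 (18.4), §18.4 Prop. 18.14, §19.
* [GelbartRogawski1991] S. Gelbart, J. Rogawski, Invent. Math. 105 (1991), §3.1 (3.1.3).
* [Liu2021] Y. Liu, *The arithmetic inner product formula*, Def. 4.1, Rem. 4.4 (conjugate-symplectic characters).
* [MoeglinWaldspurger1995] C. Mœglin, J.-L. Waldspurger, *Spectral decomposition and Eisenstein series* (1995), II.1.7, IV.1.9.
-/

set_option autoImplicit false
set_option linter.dupNamespace false -- the mandated namespace repeats `HodgeConjecture.HodgeConjecture`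

noncomputable section

open scoped Matrix BigOperators NNReal ENNReal ComplexConjugate RestrictedProduct
-- `Classical` is needed to see the Mathlib normed-ring instances on `mixedSpace L` (note H5 of ★ `AdelicGLnGlue`; as the TOP's `hτ`)
open scoped Classical
open NumberField NumberField.InfinitePlace IsDedekindDomain MeasureTheory Measure
open Literature.NumberTheory.Automorphic Literature.NumberTheory.GaloisRepresentations Literature.NumberTheory.LFunctions
open Literature.NumberTheory.Automorphic.UnitaryGroup (archAt archPart archLocal)
open Literature.NumberTheory.GelbartRogawski1991 Literature.NumberTheory.GelbartRogawski1991.GRConstruction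
open Literature.NumberTheory.K2Lit.SiegelDoubled Literature.NumberTheory.K2Lit.PlaceSplitting
open Literature.MeasureTheory.RestrictedProduct
open Literature.Topology.Algebra.RestrictedProduct (inH)
open Literature.NumberTheory.Automorphic.IdeleClassGroup (toHeckeCharacter isUnitary_toHeckeCharacter IsConjugateSymplectic)
open Summit.HodgeConjecture.HodgeConjecture.Cruxes.HLiu418.K2LiuSiegelUnipotentLocalDefs
open Summit.HodgeConjecture.HodgeConjecture.Cruxes.HLiu418.K2LiuSiegelUnipotentSplitAtDefs
open Summit.HodgeConjecture.HodgeConjecture.Cruxes.HLiu418.K2LiuSiegelUnipotentFourierDefs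
open Summit.HodgeConjecture.HodgeConjecture.Cruxes.HLiu418.K2LiuSiegelEisensteinKindWLetters (kindWPlaces kindWFinset)
open Summit.HodgeConjecture.HodgeConjecture.Cruxes.HLiu418.K2LiuSiegelEisensteinKindWOfRecordLocal (kindW_block_of_record_local)
open Summit.HodgeConjecture.HodgeConjecture.Cruxes.HLiu418.K2LiuKindWCarrierOfRecord (exists_kindW_carrierLetters)
open Summit.HodgeConjecture.HodgeConjecture.Cruxes.HLiu418.K2LiuKindWGoodPlaceFactorCofinite (exists_finset_hJ_toHeckeCharacter)
open Summit.HodgeConjecture.HodgeConjecture.Cruxes.HLiu418.K2LiuKindWFinitePartLettersOfRecord (hfsupp_of_levelLetters hfsize_of_placeLetters hdelta_eq_zero_off)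
open Summit.HodgeConjecture.HodgeConjecture.Cruxes.HLiu418.K2LiuSiegelEisensteinKindWArchAdapter (harch_of_blockLetters)

namespace Summit.HodgeConjecture.HodgeConjecture.Cruxes.HLiu418.K2LiuKindWBlockOfRecordCMOfLetters

/-- **THE KIND-W PAYER HEAD WITH ITS CARRIERS BUILT INSIDE AND THE LETTERS `hJ`, `hfsupp`, `hfsize`, `harch` DISCHARGED BY NAME.**  At ★ p862959's frame and the TOP's `νN`,
for `μ̃ = toHeckeCharacter L lam⁻¹` with `lam` conjugate symplectic (`hlam`, the socket's binder): there are a bad set `T₀`, local carriers `νv` (Haar, σ-finite, normalised on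
`K_{H,v} ∩ N_Δ(L⁺_v)`), archimedean carriers `νinf T` (σ-finite) with the factorisation of `νN` at every finite `T`, `μ̃` unramified off `T₀`, such that FOR EVERY choice of the
remaining by-value letters — the split families `fT hfac`; the continued local letters `Finf Ffin` with holomorphy `hFinf hFfin`, the convention `hFinf0` and the half-plane
identity `hPart`; the (iii-fin) per-place LEVEL ∕ SIZE letters (`lev Tδ₀ δ₀ hδ₀ k hlev Tc c hc hsuppLoc`; `k₂ k₃ Tβ hsizeLoc`, ★ p863047's input bytes at the data of record); the
(iii-arch) index ∕ archimedean frames and the pointwise BLOCK LETTER `hBL` (★ p863137's input bytes) — the TOP's 13-slot KIND-W block holds.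
Proof: carriers ★ p862988 ⟶ `hJ` off `U₁ ⊇ T₀ᶜᵃʳʳ` ★ p863201 (`T₀ := U₁`) ⟶ `hfsupp`∕`hfsize` ★ p863047 ⟶ `harch` ★ p863137 (`hc` Mathlib `IsCMField.complexConj_ne_one`) ⟶
★ p863069 `kindW_block_of_record_local`.
[cite: KudlaRallis1994, §1–§2] [cite: Tan1999, §4 Prop. 4.8] [cite: Shimura1982, §3] [cite: Shimura1997, §18.1 (18.4), §18.4 Prop. 18.14, §19]
[cite: GelbartRogawski1991, §3.1 (3.1.3)] [cite: Liu2021, Def. 4.1, Rem. 4.4] [cite: CasselsFrohlichANT1967, Ch. XV (Tate) §3.3] [cite: MoeglinWaldspurger1995, II.1.7, IV.1.9] -/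
theorem kindW_block_cm_of_letters
    (L : Type) [Field L] [NumberField L] [IsCMField L] {n : ℕ} (e : Fin 2 × Fin 1 ≃ Fin n)
    (dV : Fin 2 → L) (hdV : ∀ i, IsCMField.complexConj L (dV i) = dV i) (hdV0 : ∀ i, dV i ≠ 0)
    (dW : Fin 1 → L) (hdW : ∀ i, IsCMField.complexConj L (dW i) = dW i) (hdW0 : ∀ i, dW i ≠ 0)
    (lam : IdeleClassGroup L →ₜ* Circle) (hlam : IsConjugateSymplectic L lam)
    (𝒦 : IwasawaDatum L e dV hdV dW hdW) (f : ℂ → HA L e dV hdV dW hdW → ℂ)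
    (hstd : IsStandardSectionFamily 𝒦 (toHeckeCharacter L lam⁻¹) f) (hcont : ∀ s, Continuous (f s))
    [MeasurableSpace (unipDelta L e dV hdV dW hdW)] [BorelSpace (unipDelta L e dV hdV dW hdW)]
    (νN : Measure (unipDelta L e dV hdV dW hdW)) [νN.IsHaarMeasure]
    [DecidableEq (HeightOneSpectrum (𝓞 (Fp L)))]
    [MeasurableSpace (unipDeltaArch L e dV hdV dW hdW)] [BorelSpace (unipDeltaArch L e dV hdV dW hdW)]
    [∀ v : HeightOneSpectrum (𝓞 (Fp L)), MeasurableSpace (unipDeltaLoc L e dV hdV dW hdW v)]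
    [∀ v : HeightOneSpectrum (𝓞 (Fp L)), BorelSpace (unipDeltaLoc L e dV hdV dW hdW v)] :
    ∃ (T₀ : Finset (HeightOneSpectrum (𝓞 (Fp L))))
      (νv : ∀ v : HeightOneSpectrum (𝓞 (Fp L)), Measure (unipDeltaLoc L e dV hdV dW hdW v)) (_ : ∀ v, (νv v).IsHaarMeasure) (_ : ∀ v, SigmaFinite (νv v))
      (νinf : Finset (HeightOneSpectrum (𝓞 (Fp L))) → Measure (unipDeltaArch L e dV hdV dW hdW)) (_ : ∀ T, SigmaFinite (νinf T)),
      (∀ v, νv v (((inH (fun v => UnitaryGroup.localInt L (IsCMField.complexConj L) (n + n) (hermD L e dV hdV dW hdW) v)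
      (fun v => unipDeltaLoc L e dV hdV dW hdW v) v) : Subgroup (unipDeltaLoc L e dV hdV dW hdW v)) : Set (unipDeltaLoc L e dV hdV dW hdW v)) = 1) ∧
      (∀ T : Finset (HeightOneSpectrum (𝓞 (Fp L))), Measure.map (unipDeltaSplitAt L e dV hdV dW hdW T) νN =
      (νinf T).prod ((Measure.pi fun v : T => νv v.1).prod
        (rpMeasure (fun v : {v : HeightOneSpectrum (𝓞 (Fp L)) // v ∉ T} => ((inH (fun v => UnitaryGroup.localInt L (IsCMField.complexConj L) (n + n) (hermD L e dV hdV dW hdW) v)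
          (fun v => unipDeltaLoc L e dV hdV dW hdW v) v.1 : Subgroup (unipDeltaLoc L e dV hdV dW hdW v.1)) : Set (unipDeltaLoc L e dV hdV dW hdW v.1))) (fun v => νv v.1) ∅))) ∧
      (∀ v, v ∉ T₀ → ∀ w' : UnitaryGroup.PlacesOver L v, (toHeckeCharacter L lam⁻¹).IsUnramifiedAt w'.1) ∧
    ∀
        {fT : ∀ T : Finset (HeightOneSpectrum (𝓞 (Fp L))), ℂ → UnitaryGroup.arch (Fp L) L (IsCMField.complexConj L) (n + n) (hermD L e dV hdV dW hdW) ×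
          (Π v : T, UnitaryGroup.localPi L (IsCMField.complexConj L) (n + n) (hermD L e dV hdV dW hdW) v.1) → ℂ}
        (hfac : ∀ T : Finset (HeightOneSpectrum (𝓞 (Fp L))), T₀ ⊆ T → IsFactorizableOff L e dV hdV dW hdW T (toHeckeCharacter L lam⁻¹) f (fT T))
        -- the CONTINUED local letters (by value) and their holomorphy on `{0 < re s}`, the convention at singular indices, and the half-plane identity `hPart`
        {m : ℕ} (Finf : Fin m → skewMatrices ((IsCMField.complexConj L : L ≃ₐ[Fp L] L) : L →+* L) ((gramR L e dV hdV dW hdW).map (algebraMap (Fp L) L)) → ℂ → HA L e dV hdV dW hdW → ℂ)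
        (Ffin : Fin m → skewMatrices ((IsCMField.complexConj L : L ≃ₐ[Fp L] L) : L →+* L) ((gramR L e dV hdV dW hdW).map (algebraMap (Fp L) L)) → HA L e dV hdV dW hdW →
          HeightOneSpectrum (𝓞 (Fp L)) → ℂ → ℂ)
        (hFinf : ∀ j S (h : HA L e dV hdV dW hdW), DifferentiableOn ℂ (fun s => Finf j S s h) {s : ℂ | 0 < s.re})
        (hFfin : ∀ j S (h : HA L e dV hdV dW hdW) v, DifferentiableOn ℂ (Ffin j S h v) {s : ℂ | 0 < s.re})
        (hFinf0 : ∀ (j : Fin m) (S : skewMatrices ((IsCMField.complexConj L : L ≃ₐ[Fp L] L) : L →+* L) ((gramR L e dV hdV dW hdW).map (algebraMap (Fp L) L)))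
          (s : ℂ) (h : HA L e dV hdV dW hdW), (S : Matrix (Fin n) (Fin n) L).det = 0 → Finf j S s h = 0)
        (hPart : ∀ (S : skewMatrices ((IsCMField.complexConj L : L ≃ₐ[Fp L] L) : L →+* L) ((gramR L e dV hdV dW hdW).map (algebraMap (Fp L) L))) (h : HA L e dV hdV dW hdW) (s : ℂ),
          (n : ℝ) / 2 < s.re → (S : Matrix (Fin n) (Fin n) L).det ≠ 0 →
          K2LiuSiegelEisensteinKindWLetters.kindWPart L e dV hdV dW hdW (kindWFinset L e dV hdV dW hdW T₀ (S : Matrix (Fin n) (Fin n) L) h)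
              (νinf (kindWFinset L e dV hdV dW hdW T₀ (S : Matrix (Fin n) (Fin n) L) h)) νv
              (fT (kindWFinset L e dV hdV dW hdW T₀ (S : Matrix (Fin n) (Fin n) L) h)) (S : Matrix (Fin n) (Fin n) L) s h =
            ∑ j, Finf j S s h * ∏ v ∈ kindWFinset L e dV hdV dW hdW T₀ (S : Matrix (Fin n) (Fin n) L) h, Ffin j S h v s)
        -- (iii-fin) THE PER-PLACE LEVEL LETTERS (★ p863047 `hfsupp_of_levelLetters`' inputs at the data of record)
        (lev : HA L e dV hdV dW hdW → HeightOneSpectrum (𝓞 L) → ℕ) (Tδ₀ : Finset (HeightOneSpectrum (𝓞 L))) (δ₀ : HeightOneSpectrum (𝓞 L) → ℕ) (hδ₀ : ∀ w ∉ Tδ₀, δ₀ w = 0) (k : ℕ)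
        (hlev : ∀ (h : HA L e dV hdV dW hdW) (w : HeightOneSpectrum (𝓞 L)),
          ((Ideal.absNorm w.asIdeal : ℕ) : ℝ) ^ lev h w ≤ ((Ideal.absNorm w.asIdeal : ℕ) : ℝ) ^ δ₀ w * (GLn.localHeight (n + n) L w (h : GL (Fin (n + n)) (AdeleRing (𝓞 L) L)) : ℝ) ^ k)
        (Tc : Finset (HeightOneSpectrum (𝓞 L))) (c : HeightOneSpectrum (𝓞 L) → ℕ) (hc : ∀ w ∉ Tc, c w = 0)
        (hsuppLoc : ∀ (v : HeightOneSpectrum (𝓞 (Fp L))) (j : Fin m)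
          (S : skewMatrices ((IsCMField.complexConj L : L ≃ₐ[Fp L] L) : L →+* L) ((gramR L e dV hdV dW hdW).map (algebraMap (Fp L) L))) (s : ℂ) (h : HA L e dV hdV dW hdW),
          v ∈ kindWFinset L e dV hdV dW hdW T₀ (S : Matrix (Fin n) (Fin n) L) h → 0 < s.re → Ffin j S h v s ≠ 0 →
          ∀ (w : UnitaryGroup.PlacesOver L v) (a b : Fin n),
            Valued.v ((((S : Matrix (Fin n) (Fin n) L) a b : L)) : w.1.adicCompletion L) ≤ WithZero.exp (((lev h w.1 + c w.1 : ℕ) : ℤ)))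
        -- (iii-fin) THE PER-PLACE SIZE LETTERS (★ p863047 `hfsize_of_placeLetters`' inputs at the data of record, `τ S := ‖(ι_∞ S_{ij})‖`)
        (k₂ k₃ : ℕ) (Tβ : Finset (HeightOneSpectrum (𝓞 L)))
        (hsizeLoc : ∀ z : ℂ, 0 < z.re → ∃ (r : ℝ) (k₁ : ℕ) (β : HeightOneSpectrum (𝓞 L) → ℕ), 0 < r ∧ (∀ w ∉ Tβ, β w = 0) ∧
          ∀ (j : Fin m) (S : skewMatrices ((IsCMField.complexConj L : L ≃ₐ[Fp L] L) : L →+* L) ((gramR L e dV hdV dW hdW).map (algebraMap (Fp L) L))) (s : ℂ),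
          dist s z < r → ∀ (h : HA L e dV hdV dW hdW) (v : HeightOneSpectrum (𝓞 (Fp L))), v ∈ kindWFinset L e dV hdV dW hdW T₀ (S : Matrix (Fin n) (Fin n) L) h →
          ∀ (dS dA : HeightOneSpectrum (𝓞 L) → ℕ),
            (∀ (w : UnitaryGroup.PlacesOver L v) (a b : Fin n), Valued.v ((((S : Matrix (Fin n) (Fin n) L) a b : L)) : w.1.adicCompletion L) ≤ WithZero.exp ((dS w.1 : ℕ) : ℤ)) →
            (∀ (w : UnitaryGroup.PlacesOver L v) (a b : Fin n), Valued.v ((((S : Matrix (Fin n) (Fin n) L)⁻¹ a b : L)) : w.1.adicCompletion L) ≤ WithZero.exp ((dA w.1 : ℕ) : ℤ)) →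
            ‖Ffin j S h v s‖ ≤ ∏ w : UnitaryGroup.PlacesOver L v,
              ((Ideal.absNorm w.1.asIdeal : ℕ) : ℝ) ^ β w.1 * (GLn.localHeight (n + n) L w.1 (h : GL (Fin (n + n)) (AdeleRing (𝓞 L) L)) : ℝ) ^ k₁ *
                ((Ideal.absNorm w.1.asIdeal : ℕ) : ℝ) ^ (k₂ * dS w.1 + k₃ * dA w.1))
        -- (iii-arch) THE INDEX FRAMES (★ FILE 2d), THE ARCHIMEDEAN FRAMES (★ G7-C), AND THE POINTWISE BLOCK LETTER («Φ6b-ind»; ★ p863137 `harch_of_blockLetters`' inputs)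
        {Sinf : Type} [Fintype Sinf]
        (φ : Sinf → (L →+* ℂ)) (A B Ainv Binv : Sinf → Matrix (Fin n) (Fin n) ℂ) {Mf : ℝ} (hMf : 1 ≤ Mf)
        (hA : ∀ σ i j, ‖A σ i j‖ ≤ Mf) (hB : ∀ σ i j, ‖B σ i j‖ ≤ Mf) (hAe : ∀ σ i j, ‖Ainv σ i j‖ ≤ Mf) (hBe : ∀ σ i j, ‖Binv σ i j‖ ≤ Mf)
        (hAi : ∀ σ, Ainv σ * A σ = 1) (hBi : ∀ σ, B σ * Binv σ = 1) (hcover : ∀ w : InfinitePlace L, ∃ σ, InfinitePlace.mk (φ σ) = w)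
        (w : Sinf → {w : InfinitePlace L // IsComplex w}) (hw : ∀ σ, (IsCMField.complexConj L : L ≃ₐ[Fp L] L) • (w σ).1 = (w σ).1)
        (er : Fin n ⊕ Fin n ≃ Fin (n + n)) (T Tinv : Sinf → Matrix (Fin n ⊕ Fin n) (Fin n ⊕ Fin n) ℂ) (hT : ∀ σ, T σ * Tinv σ = 1)
        {M : ℝ} (hM : 1 ≤ M) (hTe : ∀ σ i j, ‖T σ i j‖ ≤ M) (hTe' : ∀ σ i j, ‖Tinv σ i j‖ ≤ M)
        (hBL : ∀ z : ℂ, 0 < z.re → ∃ (cg Ng N'g Kt C a r : ℝ), 0 < cg ∧ 0 ≤ Ng ∧ 0 ≤ N'g ∧ 1 ≤ Kt ∧ 0 ≤ C ∧ 0 ≤ a ∧ 0 < r ∧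
          ∀ (j : Fin m) (S : skewMatrices ((IsCMField.complexConj L : L ≃ₐ[Fp L] L) : L →+* L) ((gramR L e dV hdV dW hdW).map (algebraMap (Fp L) L))) (s : ℂ),
          dist s z < r → (S : Matrix (Fin n) (Fin n) L).det ≠ 0 →
          ∀ (h : HA L e dV hdV dW hdW) (y b d : Sinf → Matrix (Fin n) (Fin n) ℂ) (κ κ' : Sinf → Matrix (Fin n ⊕ Fin n) (Fin n ⊕ Fin n) ℂ),
          (∀ σ, κ σ * κ' σ = 1) → (∀ σ, κ' σ * κ σ = 1) → (∀ σ i j, ‖κ σ i j‖ ≤ M) → (∀ σ i j, ‖κ' σ i j‖ ≤ M) →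
          (∀ σ, T σ * Matrix.reindex er.symm er.symm
              ((((archAt (Fp L) L (IsCMField.complexConj L : L ≃ₐ[Fp L] L) (n + n) (hermD L e dV hdV dW hdW) (w σ) (hw σ) (IsCMField.complexConj_ne_one L)
                  (archPart (Fp L) L (IsCMField.complexConj L : L ≃ₐ[Fp L] L) (n + n) (hermD L e dV hdV dW hdW) h) :
                  archLocal L (n + n) (hermD L e dV hdV dW hdW) (w σ)) : GL (Fin (n + n)) ℂ) : Matrix (Fin (n + n)) (Fin (n + n)) ℂ)) * Tinv σ =
            Matrix.fromBlocks (y σ) (b σ) 0 (d σ) * κ σ) →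
          ∃ t : Sinf → ℝ,
            (∀ σ a b, ‖((y σ)ᴴ * (A σ * ((S : Matrix (Fin n) (Fin n) L).map (φ σ)) * B σ) * y σ) a b‖ ≤ t σ) ∧
            (∀ σ, t σ ≤ Kt * ∑ a, ∑ b, ‖((y σ)ᴴ * (A σ * ((S : Matrix (Fin n) (Fin n) L).map (φ σ)) * B σ) * y σ) a b‖) ∧
            ‖Finf j S s h‖ ≤ C * adelicHeightGL (n + n) L (h : GL (Fin (n + n)) (AdeleRing (𝓞 L) L)) ^ a *
              ∏ σ, (Real.exp (-(cg * t σ)) * (1 + t σ) ^ Ng *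
                (1 + ‖((y σ)ᴴ * (A σ * ((S : Matrix (Fin n) (Fin n) L).map (φ σ)) * B σ) * y σ).det‖ ^ (-N'g)))),
    ∃ (A : skewMatrices ((IsCMField.complexConj L : L ≃ₐ[Fp L] L) : L →+* L) ((gramR L e dV hdV dW hdW).map (algebraMap (Fp L) L)) → ℂ → HA L e dV hdV dW hdW → ℂ)
      (U : skewMatrices ((IsCMField.complexConj L : L ≃ₐ[Fp L] L) : L →+* L) ((gramR L e dV hdV dW hdW).map (algebraMap (Fp L) L)) → HA L e dV hdV dW hdW →
        Set (HeightOneSpectrum (𝓞 ↥(maximalRealSubfield L)))),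
      (∀ S : skewMatrices ((IsCMField.complexConj L : L ≃ₐ[Fp L] L) : L →+* L) ((gramR L e dV hdV dW hdW).map (algebraMap (Fp L) L)),
        (S : Matrix (Fin n) (Fin n) L).det ≠ 0 → ∀ (s : ℂ) (h : HA L e dV hdV dW hdW), (n : ℝ) / 2 < s.re →
          whittakerDelta L e dV hdV dW hdW νN (S : Matrix (Fin n) (Fin n) L) (f s) h =
            A S s h * (partialStandardL (U S h) (fun _ => {1}) (2 * s + 1) *
              partialStandardL (U S h) (fun v => {(quadraticHeckeCharCM L).valueAtUniformizer v}) (2 * s + 2))⁻¹) ∧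
      (∀ S (h : HA L e dV hdV dW hdW), DifferentiableOn ℂ (fun s => A S s h) {s : ℂ | 0 < s.re}) ∧
      ∃ (τ : skewMatrices ((IsCMField.complexConj L : L ≃ₐ[Fp L] L) : L →+* L) ((gramR L e dV hdV dW hdW).map (algebraMap (Fp L) L)) → ℝ) (NW : ℕ),
        (∀ S : skewMatrices ((IsCMField.complexConj L : L ≃ₐ[Fp L] L) : L →+* L) ((gramR L e dV hdV dW hdW).map (algebraMap (Fp L) L)),
          ‖(fun i j => NumberField.mixedEmbedding L ((S : Matrix (Fin n) (Fin n) L) i j))‖ ≤ τ S) ∧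
        (∀ z : ℂ, 0 < z.re → ∃ C a c a' r : ℝ, 0 ≤ C ∧ 0 ≤ a ∧ 0 < c ∧ 0 ≤ a' ∧ 0 < r ∧ ∀ S (s : ℂ), dist s z < r → ∀ h : HA L e dV hdV dW hdW,
          ‖A S s h‖ ≤ C * adelicHeightGL (n + n) L (h : GL (Fin (n + n)) (AdeleRing (𝓞 L) L)) ^ a *
            (Real.exp (-(c * adelicHeightGL (n + n) L (h : GL (Fin (n + n)) (AdeleRing (𝓞 L) L)) ^ (-a') * τ S)) * (1 + τ S) ^ NW)) ∧
        ∃ CW κ : ℝ, 0 < CW ∧ 0 ≤ κ ∧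
          ∀ S (s : ℂ) (h : HA L e dV hdV dW hdW), 0 < s.re → A S s h ≠ 0 →
            ∃ D : ℕ, 1 ≤ D ∧ (D : ℝ) ≤ CW * adelicHeightGL (n + n) L (h : GL (Fin (n + n)) (AdeleRing (𝓞 L) L)) ^ κ ∧
              ∀ i j, IsIntegral ℤ ((D : L) * (S : Matrix (Fin n) (Fin n) L) i j) := by
  -- the frame is rank two: `n = 2`
  have hn2 : n = 2 := by
    have h2 : Fintype.card (Fin 2 × Fin 1) = Fintype.card (Fin n) := Fintype.card_congr e
    simp only [Fintype.card_prod, Fintype.card_fin] at h2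
    omega
  subst hn2
  haveI : NeZero (2 + 2) := ⟨by omega⟩
  -- the carriers of record (★ p862988), unpacked by projections (an `obtain` on this instance-laden goal times out)
  have h := exists_kindW_carrierLetters L e dV hdV dW hdW (toHeckeCharacter L lam⁻¹) νN
  have h1 := h.choose_spec
  have h2 := h1.choose_spec
  have h3 := h2.choose_spec
  have h4 := h3.choose_spec
  have h5 := h4.2.choose_spec
  haveI := h2.choose
  haveI := h3.choose
  -- `hJ` off a finite `U₁ ⊇ T₀ᶜᵃʳʳ` (★ p863201, no kit, no by-value letter); the head's `T₀ := U₁`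
  have hU := exists_finset_hJ_toHeckeCharacter L e dV hdV dW hdW hdV0 hdW0 lam hlam h.choose h1.choose h4.1 h5.2.2
  have hU₁ : h.choose ⊆ hU.choose := hU.choose_spec.1
  have hJ := hU.choose_spec.2
  refine ⟨hU.choose, h1.choose, h2.choose, h3.choose, h4.2.choose, h5.1, h4.1, h5.2.1, fun v hv => h5.2.2 v fun h' => hv (hU₁ h'), ?_⟩
  intro fT hfac m Finf Ffin hFinf hFfin hFinf0 hPart lev Tδ₀ δ₀ hδ₀ k hlev Tc c hc hsuppLoc k₂ k₃ Tβ hsizeLoc Sinf _ φ A B Ainv Binv Mf hMf hA hB hAe hBe hAi hBi hcover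
    w hw er T Tinv hT M hM hTe hTe' hBL
  -- `hfsupp` ★ p863047 (`δ := δ₀ + c` off `T_{δ₀} ∪ T_c`)
  have hfsupp := hfsupp_of_levelLetters L (N := 2 + 2)
    (fun S : skewMatrices ((IsCMField.complexConj L : L ≃ₐ[Fp L] L) : L →+* L) ((gramR L e dV hdV dW hdW).map (algebraMap (Fp L) L)) => (S : Matrix (Fin 2) (Fin 2) L))
    (fun x : HA L e dV hdV dW hdW => (x : GL (Fin (2 + 2)) (AdeleRing (𝓞 L) L)))
    (fun S x => kindWFinset L e dV hdV dW hdW hU.choose (S : Matrix (Fin 2) (Fin 2) L) x) (fun v j S s x => Ffin j S x v s) lev δ₀ k hlev c hsuppLoc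
  beta_reduce at hfsupp
  -- `hfsize` ★ p863047 (global exponents, a fortiori local)
  have hfsizeG := hfsize_of_placeLetters L (N := 2 + 2)
    (fun S : skewMatrices ((IsCMField.complexConj L : L ≃ₐ[Fp L] L) : L →+* L) ((gramR L e dV hdV dW hdW).map (algebraMap (Fp L) L)) => (S : Matrix (Fin 2) (Fin 2) L))
    (fun x : HA L e dV hdV dW hdW => (x : GL (Fin (2 + 2)) (AdeleRing (𝓞 L) L)))
    (fun S x => kindWFinset L e dV hdV dW hdW hU.choose (S : Matrix (Fin 2) (Fin 2) L) x) (fun v j S s x => Ffin j S x v s)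
    (fun S => ‖(fun i j => NumberField.mixedEmbedding L ((S : Matrix (Fin 2) (Fin 2) L) i j))‖) (fun S => le_rfl) k₂ k₃ Tβ hsizeLoc
  beta_reduce at hfsizeG
  have hfsize : ∀ z : ℂ, 0 < z.re → ∃ (N₂ N₃ : ℕ) (C a r : ℝ), 0 ≤ C ∧ 0 ≤ a ∧ 0 < r ∧ ∀ (j : Fin m)
      (S : skewMatrices ((IsCMField.complexConj L : L ≃ₐ[Fp L] L) : L →+* L) ((gramR L e dV hdV dW hdW).map (algebraMap (Fp L) L))) (s : ℂ),
      dist s z < r → ∀ (x : HA L e dV hdV dW hdW) (D : ℕ), 1 ≤ D → (∀ a b, IsIntegral ℤ ((D : L) * (S : Matrix (Fin 2) (Fin 2) L) a b)) →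
      ‖∏ v ∈ kindWFinset L e dV hdV dW hdW hU.choose (S : Matrix (Fin 2) (Fin 2) L) x, Ffin j S x v s‖ ≤
        C * adelicHeightGL (2 + 2) L (x : GL (Fin (2 + 2)) (AdeleRing (𝓞 L) L)) ^ a *
          (1 + ‖(fun i j => NumberField.mixedEmbedding L ((S : Matrix (Fin 2) (Fin 2) L) i j))‖) ^ N₂ * (D : ℝ) ^ N₃ := by
    intro z hz
    have hh := hfsizeG z hz   -- (an `obtain` straight on the application re-elaborates the instance-laden type and times out)
    obtain ⟨C, a, r, hC, ha, hr, hb⟩ := hh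
    refine ⟨2 * Module.finrank ℚ L * k₃, Module.finrank ℚ L * (k₂ + 2 * k₃), C, a, r, hC, ha, hr, ?_⟩
    intro j S s hs x D hD hDi
    exact hb j S s hs x D hD hDi
  -- `harch` ★ p863137 (`hc` by Mathlib `IsCMField.complexConj_ne_one`)
  have harch := harch_of_blockLetters L e dV hdV dW hdW (IsCMField.complexConj_ne_one L) φ A B Ainv Binv hMf hA hB hAe hBe hAi hBi hcover w hw er T Tinv hT hM hTe hTe'
    Finf hFinf0 hBL
  -- ★ p863069 `kindW_block_of_record_local` at `T₀ := U₁`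
  exact kindW_block_of_record_local L e dV hdV hdV0 dW hdW hdW0 lam 𝒦 f hstd hcont νN hU.choose h1.choose h4.1 h4.2.choose h5.1 h5.2.1
    (fun v hv => h5.2.2 v fun h' => hv (hU₁ h')) hfac hJ Finf Ffin hFinf hFfin hPart (Tδ₀ ∪ Tc) (δ₀ + c) (hdelta_eq_zero_off L Tδ₀ Tc δ₀ c hδ₀ hc) k hfsupp harch hfsize

end Summit.HodgeConjecture.HodgeConjecture.Cruxes.HLiu418.K2LiuKindWBlockOfRecordCMOfLetters

end
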